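import Mathlib
import HarnessLib
import Literature.Analysis.FluidPDE.SelfSimilar
import Literature.Analysis.FluidPDE.LocalTypeI
import Literature.Analysis.FluidPDE.VectorCalculus
import Literature.Analysis.FluidPDE.IsometryInvariance
import Literature.Analysis.FluidPDE.CurlIsometryCovariance
import Literature.Analysis.UnboundedOperators.HeatKernel
import Summits.NavierStokesRegularity.NavierStokesRegularity.Theorems.PoloidalWindowDoorPoloidalWindowRigidityRotate
import Summits.NavierStokesRegularity.NavierStokesRegularity.Theorems.PoloidalWindowDoorPoloidalWindowRigidityErtelCollapse

/-!
# Route `PoloidalWindowDoor` / `LocalVelCompTubeDoor` — ERTEL COLLAPSE in an arbitrary direction: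
# `⟪Dv·ω, e⟫ ≡ 0 ⇒ ⟪ω, e⟫ ≡ 0` for Type-I profiles and any fixed `e ≠ 0` (nsreg-p1 ROUND-9: «𝒞_e = poloidal-along-e»)

Cell ns-regularity-ideate, seat p6 (route-directed support). Rotation covariance of `…ErtelCollapse.curl_two_eq_zero_of_stretching_two_eq_zero`:
conjugating by a linear isometry `L` with `L⁻¹e₃ = e/‖e‖` (`…Rotate.exists_linearIsometryEquiv_symm_single_two`,
`…Rotate.class_conj_linearIsometryEquiv`) transports the class, the stretching (`D(LvL⁻¹) = L Dv L⁻¹`,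
`curl (LvL⁻¹) = det L • L curl v ∘ L⁻¹`, so the `e₃`-component of the conjugate stretching is `det L · ‖e‖⁻¹` times the
`e`-component of the original one) and the conclusion (`inner_curl_conj_linearIsometryEquiv_eq_zero_iff`).

* `inner_curl_eq_zero_of_inner_stretching_eq_zero` — for a profile of the class and `e ≠ 0`: if `⟪Dv(s)(y) ω(s,y), e⟫ = 0`
  for all `s < 0`, `y`, then `⟪ω(s,y), e⟫ = 0` for all `s < 0`, `y` (so the route's class `𝒞_e` IS the poloidal stratum).

WHAT THIS IS NOT: not a claim about Navier–Stokes regularity — a one-component Liouville lemma for STAGED/DRAFT door routes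
of LADDER-NS N0.
-/

noncomputable section

-- the summit and its single sub-problem share the name (CONVENTIONS §1), as in every Theorems file
set_option linter.dupNamespace false

namespace Summit.NavierStokesRegularity.NavierStokesRegularity.Theorems.PoloidalWindowDoorPoloidalWindowRigidityErtelCollapseDirection

open MeasureTheory Set Function Filter Topology TopologicalSpace Metric
open scoped RealInnerProductSpace InnerProductSpace
open Literature.Analysis Literature.Analysis.FluidPDE
open Summit.NavierStokesRegularity.NavierStokesRegularity.Theorems.PoloidalWindowDoorPoloidalWindowRigidityRotate
open Summit.NavierStokesRegularity.NavierStokesRegularity.Theorems.PoloidalWindowDoorPoloidalWindowRigidityErtelCollapse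

variable {C : ℝ} {v : ℝ → EuclideanSpace ℝ (Fin 3) → EuclideanSpace ℝ (Fin 3)}

/-- **Ertel collapse along any direction**: for a profile of the Type-I class and a fixed `e ≠ 0`, if the `e`-component
of the vortex stretching vanishes identically then so does the `e`-component of the vorticity. -/
theorem inner_curl_eq_zero_of_inner_stretching_eq_zero (hrate : HasTypeITimeDecay C v)
    (hcont : ContinuousOn (uncurry v) (Iio (0 : ℝ) ×ˢ univ))
    (hmild : ∀ s t : ℝ, s < t → t < 0 → ∀ x,
      v t x = UnboundedOperators.heatExtension (v s) (t - s) x - oseenDuhamel 1 s v v t x)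
    (hdiv : ∀ t < 0, VectorCalculus.IsDivFree (v t)) {e : EuclideanSpace ℝ (Fin 3)} (he : e ≠ 0)
    (hstr : ∀ s < 0, ∀ y, ⟪fderiv ℝ (v s) y (curl (v s) y), e⟫_ℝ = 0) :
    ∀ s < 0, ∀ y, ⟪curl (v s) y, e⟫_ℝ = 0 := by
  obtain ⟨L, hL⟩ := exists_linearIsometryEquiv_symm_single_two he
  obtain ⟨hrate', hcont', hmild', hdiv'⟩ := class_conj_linearIsometryEquiv L hrate hcont hmild hdiv
  -- the `e₃`-component of the conjugate stretching vanishes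
  have hstr' : ∀ s < 0, ∀ y, ⟪fderiv ℝ ((fun t x => L (v t (L.symm x))) s) y
      (curl ((fun t x => L (v t (L.symm x))) s) y), EuclideanSpace.single 2 1⟫_ℝ = 0 := by
    intro s hs y
    have hD : ∀ w, fderiv ℝ (fun x => L (v s (L.symm x))) y w = L (fderiv ℝ (v s) (L.symm y) (L.symm w)) := by
      intro w
      rw [fderiv_conj_linearIsometryEquiv]
      rfl
    have hC : curl (fun x => L (v s (L.symm x))) y =
        (L : EuclideanSpace ℝ (Fin 3) →L[ℝ] EuclideanSpace ℝ (Fin 3)).det • L (curl (v s) (L.symm y)) :=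
      curl_conj_linearIsometryEquiv L (v s) y
    show ⟪fderiv ℝ (fun x => L (v s (L.symm x))) y (curl (fun x => L (v s (L.symm x))) y),
      EuclideanSpace.single 2 1⟫_ℝ = 0
    rw [hD, hC]
    simp only [map_smul, LinearIsometryEquiv.symm_apply_apply, real_inner_smul_left]
    rw [LinearIsometryEquiv.inner_map_eq_flip, hL, inner_smul_right, hstr s hs (L.symm y), mul_zero, mul_zero]
  -- the `e₃`-collapse for the conjugate, read back through the pseudovector law
  have h3 := curl_two_eq_zero_of_stretching_two_eq_zero hrate' hcont' hmild' hdiv' hstr'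
  intro s hs z
  have hz := h3 s hs (L z)
  have hz' : ⟪curl ((fun t x => L (v t (L.symm x))) s) (L z), EuclideanSpace.single 2 1⟫_ℝ = 0 := by
    simp [EuclideanSpace.inner_single_right, hz]
  have key := (inner_curl_conj_linearIsometryEquiv_eq_zero_iff L (v s) (L z) (EuclideanSpace.single 2 1)).1 hz'
  rw [LinearIsometryEquiv.symm_apply_apply, hL, inner_smul_right] at key
  exact (mul_eq_zero.1 key).resolve_left (inv_ne_zero (norm_ne_zero_iff.2 he))

end Summit.NavierStokesRegularity.NavierStokesRegularity.Theorems.PoloidalWindowDoorPoloidalWindowRigidityErtelCollapseDirection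

end
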